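import Literature.Dynamics.Ergodic.MixingMeasuresAbsolutelyContinuous
import Literature.AlgebraicGeometry.HodgeTheory.AbelianVarietyDensitiesEquidistribute
import Literature.AlgebraicGeometry.HodgeTheory.AbelianVarietyAffineSelfMapsMixing
import HarnessLib

/-!
# Absolutely continuous distributions converge to the Haar measure under a mixing isogeny / a mixing affine
# self-map of a complex abelian variety (Walters, Lemma 6.11 (ii), Theorem 6.12 (ii) on `A(ℂ)`)

Lane `lit-hodgefound`, row A1-30⁺⁴¹ / (A1-30⁺³⁸)⁺ / (A1-30⁺²⁶)⁺ / (A1-30⁺²⁸)⁺ (prover seat `lit-hodgefound-p31`): the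
lane file of `Literature/Dynamics/Ergodic/MixingMeasuresAbsolutelyContinuous.lean`, read on the compact metrisable
group `A(ℂ)` of a complex abelian variety with its Haar probability measure `μ`.  Row A1-30⁺²⁶: for EVERY
endomorphism `f` of `A`, `f(ℂ)` is strong-mixing iff ergodic (Walters Thm. 1.28), iff (for an isogeny) no
eigenvalue of `f^*` on `H¹(A(ℂ), ℚ)` is a root of unity; row A1-30⁺²⁸: the affine self-map `P ↦ f(ℂ)(P) · Q` is
strong-mixing iff `f(ℂ)` is ergodic (Thm. 1.29); row A1-30⁺³⁸: the Cesàro (ergodic) versions Lemma 6.11 (i) /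
Theorem 6.12 (i) on `A(ℂ)`.

Printed statements.  P. Walters, *An Introduction to Ergodic Theory*, GTM 79 (1982), §6.3 (held text chunks
p0164–p0165): **Lemma 6.11 (ii)** «`μ` is strong mixing iff `∀ f ∈ C(X) ∀ g ∈ L¹(μ)`
`∫ f(Tⁿx) g(x) dμ(x) → ∫ f dμ ∫ g dμ`»; **Theorem 6.12 (ii)** «`μ` is strong mixing iff whenever `m ∈ M(X)` and
`m ≪ μ` then `T̃ⁿm → μ`»; §1.7 Theorem 1.23 (iii) (chunks p0059–p0060).

Typing.  `A : Motives.AbelianVariety ℂ`, the Borel σ-algebra on `A(ℂ) = ComplexPoints A.X`, the translation-invariant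
Borel probability measure `μ` (`hμ`), an endomorphism `f : A ⟶ A` with `f(ℂ) = AlgPoints.mapContinuous f.hom.hom.hom`,
test functions `F ∈ C(A(ℂ), ℝ)`, densities `g ∈ L¹(μ)` (`Integrable g μ`), absolutely continuous initial
distributions `m ≪ μ` (Borel probability measures); weak* convergence is stated on test functions, setwise
convergence on Borel sets.

## Contents (theorems only; no definition, no named fact, net debt 0)

`AbelianVariety.tendsto_integral_mul_mapContinuous` (LEMMA 6.11 (ii) ⟹: under an isogeny with no root-of-unity
eigenvalue the correlations `∫ F(f(ℂ)ⁿP) g(P) dμ` — NOT averaged — decay against every integrable density),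
**`AbelianVariety.ergodic_mapContinuous_iff_tendsto_integral_mul`** (LEMMA 6.11 (ii) on `A(ℂ)` as a criterion for
ergodicity = strong mixing), **`AbelianVariety.ergodic_mapContinuous_iff_forall_absolutelyContinuous_map_tendsto`**
(THEOREM 6.12 (ii) on `A(ℂ)`), **`AbelianVariety.tendsto_integral_comp_iterate_of_absolutelyContinuous`** (every
absolutely continuous `m` is pushed to `μ` weak*), **`AbelianVariety.tendsto_measure_preimage_iterate_of_absolutelyContinuous`**
(`m(f(ℂ)^{−n}B) → μ(B)` for every Borel `B`), `AbelianVariety.tendsto_integral_comp_iterate_mul_of_absolutelyContinuous`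
and `AbelianVariety.tendsto_measure_preimage_iterate_mul_of_absolutelyContinuous` (the same for the affine self-maps
`P ↦ f(ℂ)(P) · Q`).

## References

* [Walters1982] P. Walters, *An Introduction to Ergodic Theory*, Springer GTM 79 (1982): §6.3 Lemma 6.11 (ii),
  Theorem 6.12 (ii) (held text chunks p0164–p0165); §1.7 Theorem 1.23 (iii), Theorems 1.28, 1.29 (held text chunks
  p0059–p0063).
* [EverestWard1999] G. Everest, T. Ward, *Heights of Polynomials and Entropy in Algebraic Dynamics* (1999), Ch. 2
  Lemma 2.2 — ergodicity of toral endomorphisms (row A1-30⁺²⁵).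
-/

noncomputable section

open scoped Topology
open CategoryTheory Function MeasureTheory MeasureTheory.Measure Set Filter
open Literature.Dynamics.Ergodic
open Literature.AlgebraicGeometry.Motives (ComplexPoints AbelianVariety AlgPoints)
open Literature.AlgebraicTopology.SingularHomology Literature.NumberTheory.LFunctions

namespace Literature.AlgebraicGeometry.HodgeTheory

open Literature.Geometry.Kaehler

section MixingDensities

variable (A : AbelianVariety ℂ) (f : A ⟶ A) [MeasurableSpace (ComplexPoints A.X)] [BorelSpace (ComplexPoints A.X)]
  (μ : Measure (ComplexPoints A.X)) [IsProbabilityMeasure μ]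
  (hμ : ∀ Q : A.Points ℂ, Measure.map (fun P : A.Points ℂ ↦ P * Q) μ = μ)

omit [MeasurableSpace (ComplexPoints A.X)] [BorelSpace (ComplexPoints A.X)] in
/-- `A(ℂ)` is metrisable (homeomorphic to a torus `(ℝ/ℤ)^ι`). [folklore] -/
private theorem metrizableSpace_points₄ : TopologicalSpace.MetrizableSpace (ComplexPoints A.X) := by
  obtain ⟨ι, _, _, Φ, φ, hφ, -⟩ := complexAbelianVariety_torusUniformised_holds A
  haveI : TopologicalSpace.MetrizableSpace (ComplexTorus Φ) :=
    inferInstanceAs (TopologicalSpace.MetrizableSpace (ι → AddCircle (1 : ℝ)))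
  exact hφ.homeomorph.symm.isEmbedding.metrizableSpace

omit [MeasurableSpace (ComplexPoints A.X)] [BorelSpace (ComplexPoints A.X)] in
/-- `A(ℂ)` is compact (homeomorphic to a torus). [folklore] -/
private theorem compactSpace_points₄ : CompactSpace (ComplexPoints A.X) := by
  obtain ⟨ι, _, _, Φ, φ, hφ, -⟩ := complexAbelianVariety_torusUniformised_holds A
  exact hφ.homeomorph.compactSpace

include hμ in
/-- An isogeny `f` with no root-of-unity eigenvalue on `H¹(A(ℂ), ℚ)` acts as a strong-mixing transformation of
`(A(ℂ), μ)` (rows A1-30⁺²⁵/⁺²⁶, repackaged). [cite: Walters1982, §1.7 Theorem 1.28 (held text chunk p0062)] -/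
private theorem mixing_mapContinuous_of_eigenvalues (hf : Motives.AbelianVariety.IsIsogeny f)
    (heig : ∀ α ∈ FrobeniusCharpoly.eigenvalues ℂ
        (singularCohomology.map ℚ ℚ (AlgPoints.mapContinuous (L := ℂ) f.hom.hom.hom) 1).hom,
      ∀ n : ℕ, 0 < n → α ^ n ≠ 1) :
    ∀ s t : Set (ComplexPoints A.X), MeasurableSet s → MeasurableSet t →
      Tendsto (fun n : ℕ ↦ μ ((AlgPoints.mapContinuous (L := ℂ) f.hom.hom.hom)^[n] ⁻¹' s ∩ t)) atTop
        (𝓝 (μ s * μ t)) :=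
  (AbelianVariety.mixing_mapContinuous_iff_forall_eigenvalue_pow_ne_one A f μ hμ hf).2 heig

include hμ in
/-- **Walters, Lemma 6.11 (ii) for a mixing isogeny of a complex abelian variety**: if no eigenvalue of `f^*` on
`H¹(A(ℂ), ℚ)` is a root of unity then, for every real continuous `F` on `A(ℂ)` and every `g ∈ L¹(μ)`,
`∫ F(f(ℂ)ⁿP) g(P) dμ(P) → ∫ F dμ · ∫ g dμ` (decay of correlations — not only of their Cesàro averages — against
ALL integrable densities). [cite: Walters1982, §6.3 Lemma 6.11 (ii) (held text chunks p0164–p0165)] -/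
theorem AbelianVariety.tendsto_integral_mul_mapContinuous (hf : Motives.AbelianVariety.IsIsogeny f)
    (heig : ∀ α ∈ FrobeniusCharpoly.eigenvalues ℂ
        (singularCohomology.map ℚ ℚ (AlgPoints.mapContinuous (L := ℂ) f.hom.hom.hom) 1).hom,
      ∀ n : ℕ, 0 < n → α ^ n ≠ 1)
    (F : C(ComplexPoints A.X, ℝ)) {g : ComplexPoints A.X → ℝ} (hg : Integrable g μ) :
    Tendsto (fun n : ℕ ↦ ∫ P, F ((AlgPoints.mapContinuous (L := ℂ) f.hom.hom.hom)^[n] P) * g P ∂μ) atTop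
      (𝓝 ((∫ P, F P ∂μ) * ∫ P, g P ∂μ)) :=
  Mixing.tendsto_integral_comp_iterate_mul (AlgPoints.mapContinuous (L := ℂ) f.hom.hom.hom).continuous.measurable μ
    ((AbelianVariety.measurePreserving_mapContinuous_iff_isIsogeny A f μ hμ).2 hf).map_eq
    (mixing_mapContinuous_of_eigenvalues A f μ hμ hf heig) F.continuous.measurable
    (fun x ↦ (Real.norm_eq_abs _).symm.trans_le (F.norm_coe_le_norm x)) hg

include hμ in
/-- **Walters, Lemma 6.11 (ii) on `A(ℂ)` (the criterion)**: for an isogeny `f`, `f(ℂ)` is ergodic for the Haar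
probability measure — equivalently strong-mixing (Theorem 1.28, row A1-30⁺²⁶) — iff `∫ F(f(ℂ)ⁿP) g(P) dμ → ∫ F dμ ∫ g dμ`
for all `F ∈ C(A(ℂ), ℝ)`, `g ∈ L¹(μ)`. [cite: Walters1982, §6.3 Lemma 6.11 (ii) and §1.7 Theorem 1.28 (held text chunks p0062, p0164–p0165)] -/
theorem AbelianVariety.ergodic_mapContinuous_iff_tendsto_integral_mul (hf : Motives.AbelianVariety.IsIsogeny f) :
    Ergodic (AlgPoints.mapContinuous (L := ℂ) f.hom.hom.hom) μ ↔
      ∀ (F : C(ComplexPoints A.X, ℝ)) (g : ComplexPoints A.X → ℝ), Integrable g μ →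
        Tendsto (fun n : ℕ ↦ ∫ P, F ((AlgPoints.mapContinuous (L := ℂ) f.hom.hom.hom)^[n] P) * g P ∂μ) atTop
          (𝓝 ((∫ P, F P ∂μ) * ∫ P, g P ∂μ)) := by
  haveI := metrizableSpace_points₄ A
  haveI := compactSpace_points₄ A
  rw [← AbelianVariety.mixing_mapContinuous_iff_ergodic A f μ hμ]
  exact Mixing.mixing_iff_tendsto_integral_comp_iterate_mul
    (AlgPoints.mapContinuous (L := ℂ) f.hom.hom.hom).continuous.measurable μ
    ((AbelianVariety.measurePreserving_mapContinuous_iff_isIsogeny A f μ hμ).2 hf).map_eq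

include hμ in
/-- **Walters, Theorem 6.12 (ii) for an isogeny of a complex abelian variety**: `f(ℂ)` is ergodic for the Haar
probability measure `μ` — equivalently strong-mixing (Theorem 1.28) — iff for EVERY Borel probability measure `m ≪ μ`
on `A(ℂ)` the push-forwards converge to `μ`: `f(ℂ)ⁿ_* m → μ` weak* (every absolutely continuous initial
distribution relaxes to the Haar measure, not only in Cesàro mean).
[cite: Walters1982, §6.3 Theorem 6.12 (ii) and §1.7 Theorem 1.28 (held text chunks p0062, p0165)] -/
theorem AbelianVariety.ergodic_mapContinuous_iff_forall_absolutelyContinuous_map_tendsto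
    (hf : Motives.AbelianVariety.IsIsogeny f) :
    Ergodic (AlgPoints.mapContinuous (L := ℂ) f.hom.hom.hom) μ ↔
      ∀ m : Measure (ComplexPoints A.X), IsProbabilityMeasure m → m ≪ μ →
        ∀ F : C(ComplexPoints A.X, ℝ), Tendsto (fun n : ℕ ↦
            ∫ P, F ((AlgPoints.mapContinuous (L := ℂ) f.hom.hom.hom)^[n] P) ∂m) atTop (𝓝 (∫ P, F P ∂μ)) := by
  haveI := metrizableSpace_points₄ A
  haveI := compactSpace_points₄ A
  rw [← AbelianVariety.mixing_mapContinuous_iff_ergodic A f μ hμ]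
  exact Mixing.mixing_iff_forall_absolutelyContinuous_tendsto
    (AlgPoints.mapContinuous (L := ℂ) f.hom.hom.hom).continuous.measurable μ
    ((AbelianVariety.measurePreserving_mapContinuous_iff_isIsogeny A f μ hμ).2 hf).map_eq

include hμ in
/-- **Convergence of densities to the Haar measure under a mixing isogeny** (Theorem 6.12 (ii) with row A1-30⁺²⁶):
if no eigenvalue of `f^*` on `H¹(A(ℂ), ℚ)` is a root of unity then for every Borel probability measure `m ≪ μ` and
every real continuous `F`, `∫ F∘f(ℂ)ⁿ dm → ∫ F dμ`. [cite: Walters1982, §6.3 Theorem 6.12 (ii) (held text chunk p0165)] -/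
theorem AbelianVariety.tendsto_integral_comp_iterate_of_absolutelyContinuous
    (hf : Motives.AbelianVariety.IsIsogeny f)
    (heig : ∀ α ∈ FrobeniusCharpoly.eigenvalues ℂ
        (singularCohomology.map ℚ ℚ (AlgPoints.mapContinuous (L := ℂ) f.hom.hom.hom) 1).hom,
      ∀ n : ℕ, 0 < n → α ^ n ≠ 1)
    (m : Measure (ComplexPoints A.X)) [IsProbabilityMeasure m] (hm : m ≪ μ) (F : C(ComplexPoints A.X, ℝ)) :
    Tendsto (fun n : ℕ ↦ ∫ P, F ((AlgPoints.mapContinuous (L := ℂ) f.hom.hom.hom)^[n] P) ∂m) atTop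
      (𝓝 (∫ P, F P ∂μ)) :=
  Mixing.tendsto_integral_comp_iterate_of_absolutelyContinuous
    (AlgPoints.mapContinuous (L := ℂ) f.hom.hom.hom).continuous.measurable μ
    ((AbelianVariety.measurePreserving_mapContinuous_iff_isIsogeny A f μ hμ).2 hf).map_eq
    (mixing_mapContinuous_of_eigenvalues A f μ hμ hf heig) F.continuous.measurable
    (fun x ↦ (Real.norm_eq_abs _).symm.trans_le (F.norm_coe_le_norm x)) m hm

include hμ in
/-- **Setwise convergence of the push-forwards** (Theorem 6.12 (ii) with Theorem 1.23 (iii)): under an isogeny with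
no root-of-unity eigenvalue on `H¹(A(ℂ), ℚ)`, every Borel probability measure `m ≪ μ` satisfies
`m(f(ℂ)^{−n}B) → μ(B)` for EVERY Borel set `B ⊆ A(ℂ)`.
[cite: Walters1982, §6.3 Theorem 6.12 (ii) with §1.7 Theorem 1.23 (iii) (held text chunks p0059–p0060, p0165)] -/
theorem AbelianVariety.tendsto_measure_preimage_iterate_of_absolutelyContinuous
    (hf : Motives.AbelianVariety.IsIsogeny f)
    (heig : ∀ α ∈ FrobeniusCharpoly.eigenvalues ℂ
        (singularCohomology.map ℚ ℚ (AlgPoints.mapContinuous (L := ℂ) f.hom.hom.hom) 1).hom,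
      ∀ n : ℕ, 0 < n → α ^ n ≠ 1)
    (m : Measure (ComplexPoints A.X)) [IsProbabilityMeasure m] (hm : m ≪ μ) {s : Set (ComplexPoints A.X)}
    (hs : MeasurableSet s) :
    Tendsto (fun n : ℕ ↦ m ((AlgPoints.mapContinuous (L := ℂ) f.hom.hom.hom)^[n] ⁻¹' s)) atTop (𝓝 (μ s)) :=
  Mixing.tendsto_measure_preimage_iterate_of_absolutelyContinuous
    (AlgPoints.mapContinuous (L := ℂ) f.hom.hom.hom).continuous.measurable μ
    ((AbelianVariety.measurePreserving_mapContinuous_iff_isIsogeny A f μ hμ).2 hf).map_eq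
    (mixing_mapContinuous_of_eigenvalues A f μ hμ hf heig) m hm hs

include hμ in
/-- **Theorem 6.12 (ii) for the affine self-maps `g(P) = f(ℂ)(P) · Q`** (strong-mixing iff `f(ℂ)` is ergodic,
Theorem 1.29, row A1-30⁺²⁸): if `f` is an isogeny with no root-of-unity eigenvalue on `H¹(A(ℂ), ℚ)` then for every
`Q ∈ A(ℂ)`, every Borel probability measure `m ≪ μ` and every real continuous `F`, `∫ F∘gⁿ dm → ∫ F dμ`.
[cite: Walters1982, §6.3 Theorem 6.12 (ii) and §1.7 (5) Theorem 1.29 (held text chunks p0063, p0165)] -/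
theorem AbelianVariety.tendsto_integral_comp_iterate_mul_of_absolutelyContinuous
    (hf : Motives.AbelianVariety.IsIsogeny f)
    (heig : ∀ α ∈ FrobeniusCharpoly.eigenvalues ℂ
        (singularCohomology.map ℚ ℚ (AlgPoints.mapContinuous (L := ℂ) f.hom.hom.hom) 1).hom,
      ∀ n : ℕ, 0 < n → α ^ n ≠ 1)
    (Q : A.Points ℂ) (m : Measure (ComplexPoints A.X)) [IsProbabilityMeasure m] (hm : m ≪ μ)
    (F : C(ComplexPoints A.X, ℝ)) :
    Tendsto (fun n : ℕ ↦
        ∫ P, F ((fun R : A.Points ℂ ↦ AlgPoints.mapContinuous (L := ℂ) f.hom.hom.hom R * Q)^[n] P) ∂m) atTop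
      (𝓝 (∫ P, F P ∂μ)) := by
  have hmp := (AbelianVariety.measurePreserving_mapContinuous_mul_iff_isIsogeny A f μ hμ Q).2 hf
  have hmix := (AbelianVariety.mixing_mapContinuous_mul_iff_ergodic_mapContinuous A f μ hμ Q).2
    ((AbelianVariety.ergodic_mapContinuous_iff_forall_eigenvalue_pow_ne_one A f μ hμ hf).2 heig)
  exact Mixing.tendsto_integral_comp_iterate_of_absolutelyContinuous hmp.measurable μ hmp.map_eq hmix
    F.continuous.measurable (fun x ↦ (Real.norm_eq_abs _).symm.trans_le (F.norm_coe_le_norm x)) m hm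

include hμ in
/-- **Setwise version for the affine self-maps**: under the same hypotheses, `m(g^{−n}B) → μ(B)` for every Borel
`B`, `g(P) = f(ℂ)(P) · Q`. [cite: Walters1982, §6.3 Theorem 6.12 (ii), §1.7 Theorem 1.23 (iii) and (5) Theorem 1.29 (held text chunks p0059–p0060, p0063, p0165)] -/
theorem AbelianVariety.tendsto_measure_preimage_iterate_mul_of_absolutelyContinuous
    (hf : Motives.AbelianVariety.IsIsogeny f)
    (heig : ∀ α ∈ FrobeniusCharpoly.eigenvalues ℂ
        (singularCohomology.map ℚ ℚ (AlgPoints.mapContinuous (L := ℂ) f.hom.hom.hom) 1).hom,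
      ∀ n : ℕ, 0 < n → α ^ n ≠ 1)
    (Q : A.Points ℂ) (m : Measure (ComplexPoints A.X)) [IsProbabilityMeasure m] (hm : m ≪ μ)
    {s : Set (ComplexPoints A.X)} (hs : MeasurableSet s) :
    Tendsto (fun n : ℕ ↦
        m ((fun R : A.Points ℂ ↦ AlgPoints.mapContinuous (L := ℂ) f.hom.hom.hom R * Q)^[n] ⁻¹' s)) atTop
      (𝓝 (μ s)) := by
  have hmp := (AbelianVariety.measurePreserving_mapContinuous_mul_iff_isIsogeny A f μ hμ Q).2 hf
  have hmix := (AbelianVariety.mixing_mapContinuous_mul_iff_ergodic_mapContinuous A f μ hμ Q).2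
    ((AbelianVariety.ergodic_mapContinuous_iff_forall_eigenvalue_pow_ne_one A f μ hμ hf).2 heig)
  exact Mixing.tendsto_measure_preimage_iterate_of_absolutelyContinuous hmp.measurable μ hmp.map_eq hmix m hm hs

end MixingDensities

end Literature.AlgebraicGeometry.HodgeTheory
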